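import Summits.CriticalPhenomena.SAWScalingLimit.Theorems.SAWTotalPositivityCriticalBubbleBoundJoinMacroDefs

/-!
# The TERMWISE interface of the macroscopic rarity knob (line `docking-census-joining`, crux
`SAWTotalPositivity.CriticalBubbleBound`, stmt-CriticalPhenomena-7117; lead prover c7)

The macroscopic door of the join-mass programme needs the block statement `JoinMacroRarity π`
(`Umac i ≤ C (i+1)^b 2^{-π i} R'_{i+1} + C 2^{-4 i}`, `R'_{i+1} = blockMass jterm (i+1)`). This file lands
the form in which that knob is actually measured: a bound LENGTH BY LENGTH on the uniform average.

* `joinMacroRarity_of_termwise` — suppose that at every walk length `n - 17` with `n` in the dyadic block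
  `B_{i+1}` the AVERAGE number of macroscopic global join plaquettes per lex-rooted class, i.e. the
  uniform self-avoiding-polygon expectation `E_N[#mjoins]` over the `#lexRooted (n-17)` classes with
  `N = n - 16` edges, is at most `C (i+1)^b 2^{-π i}`:
  `Σ_{χ ∈ lexRooted (n-17)} #mjoins χ ≤ C (i+1)^b 2^{-π i} · #lexRooted (n-17)`.
  Multiplying by the common class weight `x_c^{n-16}` (all classes of one length weigh the same) turns the
  right-hand side into `C (i+1)^b 2^{-π i} · cterm (n-17) = C (i+1)^b 2^{-π i} · jterm n`, and summing over
  `n ∈ B_{i+1}` gives `Umac i ≤ C (i+1)^b 2^{-π i} · blockMass jterm (i+1)` with ZERO tail, which is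
  `JoinMacroRarity π` (constant `max C 0`, so that the tail `max C 0 · 2^{-4 i}` is nonnegative).

This is the form in which the stub is tested numerically (`E_N[#mjoins] ∝ N^{-0.72}`, heuristically
`π₀ = ν (x₄ - 2) = 11/16`).

Source: A. Hammond, *An upper bound on the number of self-avoiding polygons via joining*, Ann. Probab. 46
(2018) 175–206, Prop. 4.5 (the exponential rarity of GLOBAL join plaquettes, i.e. the case `π = 0`).
-/

noncomputable section

open Literature.Probability.LatticeModels
open Literature.Probability.RandomPlanarGeometry Literature.Probability.RandomPlanarGeometry.SAW
open scoped BigOperators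
open Summit.CriticalPhenomena.SAWScalingLimit.Theorems.CriticalBubbleBound.Negative (e₀)
open Summit.CriticalPhenomena.SAWScalingLimit.Theorems.CriticalBubbleBound.Docking

namespace Summit.CriticalPhenomena.SAWScalingLimit.Theorems.CriticalBubbleBound.Join

/-- **Termwise interface of the macroscopic rarity knob.** If, for every scale `i` and every target
length `n ∈ B_{i+1}` with `n ≥ 17`, the uniform average number of macroscopic global join plaquettes of a
lex-rooted class of walk length `n - 17` is at most `C (i+1)^b 2^{-π i}`
(`Σ_χ #mjoins χ ≤ C (i+1)^b 2^{-π i} · #lexRooted (n-17)`), then `JoinMacroRarity π` holds: multiply by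
the common class weight `x_c^{n-17+1} ≥ 0` and sum over the block (`Umac i ≤ C (i+1)^b 2^{-π i} R'_{i+1}`,
zero tail; the constant is enlarged to `max C 0` to keep the ledger's tail term nonnegative).
[cite: Hammond2015SAPJoining, Proposition 4.5] -/
theorem joinMacroRarity_of_termwise : ∀ (π b C : ℝ), (∀ i : ℕ, ∀ n ∈ block (i + 1), joinShift ≤ n → ∑ χ ∈ lexRooted (n - joinShift), ((mjoins (n - joinShift) χ).card : ℝ) ≤ C * ((i : ℝ) + 1) ^ b * (2 : ℝ) ^ (-π * (i : ℝ)) * ((lexRooted (n - joinShift)).card : ℝ)) → JoinMacroRarity π := by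
  intro π b C h
  refine ⟨max C 0, b, fun i => ?_⟩
  -- nonnegativity of the factors of the ledger's right-hand side
  have hF : 0 ≤ ((i : ℝ) + 1) ^ b * (2 : ℝ) ^ (-π * (i : ℝ)) :=
    mul_nonneg (Real.rpow_nonneg (by positivity) _) (Real.rpow_nonneg (by norm_num) _)
  have hB : 0 ≤ blockMass jterm (i + 1) := blockMass_nonneg jterm_nonneg _
  have htail : 0 ≤ max C 0 * (2 : ℝ) ^ (-(4 : ℝ) * (i : ℝ)) :=
    mul_nonneg (le_max_right _ _) (Real.rpow_nonneg (by norm_num) _)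
  -- the block statement with the given constant and zero tail: sum the termwise bounds over the block
  have hmain :
      Umac i ≤ C * ((i : ℝ) + 1) ^ b * (2 : ℝ) ^ (-π * (i : ℝ)) * blockMass jterm (i + 1) := by
    unfold Umac blockMass
    rw [Finset.mul_sum]
    refine Finset.sum_le_sum fun n hn => ?_
    by_cases hle : joinShift ≤ n
    · rw [if_pos hle, jterm_of_le hle, cterm, ← Finset.sum_mul]
      have hx : 0 ≤ criticalFugacity ^ (n - joinShift + 1) :=
        pow_nonneg criticalFugacity_pos_lt_one'.1.le _
      have hmul := mul_le_mul_of_nonneg_right (h i n hn hle) hx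
      calc (∑ χ ∈ lexRooted (n - joinShift), ((mjoins (n - joinShift) χ).card : ℝ))
              * criticalFugacity ^ (n - joinShift + 1)
          ≤ C * ((i : ℝ) + 1) ^ b * (2 : ℝ) ^ (-π * (i : ℝ)) * ((lexRooted (n - joinShift)).card : ℝ)
              * criticalFugacity ^ (n - joinShift + 1) := hmul
        _ = C * ((i : ℝ) + 1) ^ b * (2 : ℝ) ^ (-π * (i : ℝ))
              * (((lexRooted (n - joinShift)).card : ℝ) * criticalFugacity ^ (n - joinShift + 1)) := by
          ring
    · rw [if_neg hle, jterm_of_lt (not_le.1 hle), mul_zero]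
  -- enlarge the constant to `max C 0` and add the nonnegative tail
  have hconst : C * ((i : ℝ) + 1) ^ b * (2 : ℝ) ^ (-π * (i : ℝ)) * blockMass jterm (i + 1)
      ≤ max C 0 * ((i : ℝ) + 1) ^ b * (2 : ℝ) ^ (-π * (i : ℝ)) * blockMass jterm (i + 1) := by
    have hmul := mul_le_mul_of_nonneg_right (le_max_left C 0) (mul_nonneg hF hB)
    calc C * ((i : ℝ) + 1) ^ b * (2 : ℝ) ^ (-π * (i : ℝ)) * blockMass jterm (i + 1)
        = C * (((i : ℝ) + 1) ^ b * (2 : ℝ) ^ (-π * (i : ℝ)) * blockMass jterm (i + 1)) := by ring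
      _ ≤ max C 0 * (((i : ℝ) + 1) ^ b * (2 : ℝ) ^ (-π * (i : ℝ)) * blockMass jterm (i + 1)) := hmul
      _ = max C 0 * ((i : ℝ) + 1) ^ b * (2 : ℝ) ^ (-π * (i : ℝ)) * blockMass jterm (i + 1) := by ring
  exact (hmain.trans hconst).trans (le_add_of_nonneg_right htail)

end Summit.CriticalPhenomena.SAWScalingLimit.Theorems.CriticalBubbleBound.Join

end
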